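import Literature.Geometry.Symplectic.OrigamiCutFormBasic
import HarnessLib

/-!
# The kernel of the cut form is the orbit line of the diagonal action

Proofs companion of `OrigamiUnfolding.lean` (the named fact
`Literature.Geometry.Symplectic.exists_symplecticCutPieces_of_isOrigamiForm`, Cannas da
Silva–Guillemin–Pires, *Symplectic Origami*, IMRN 2011 = arXiv:0909.4065, Prop. 2.8), step (S2)
continued: the cut form `Ω = p^*ωZ + d(|w|² p^*α) - 2 dx∧dy` on `ProdC k N` (`cutForm`,
`OrigamiCutFormBasic.lean`) descends to the associated bundle `N ×_{S¹} ℂ`; the descended form is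
SYMPLECTIC exactly where the kernel of `Ω` is the orbit line `ℝ · (X, iw)` of the diagonal action.
This file is the pointwise linear algebra behind it.  With `X = X_n` the fundamental vector,
`ι_X ωZ = 0`, `ι_X dα = 0`, `α(X) = 1`, and the auxiliary `2`-form on `T_n N × ℝ`

  `Θ̂_s((a,σ),(b,τ)) = ωZ(a,b) + s dα(a,b) + σ α(b) - τ α(a)`:

* `cutForm_kernel_of_aux` — if `Θ̂_{|w|²}` is non-degenerate then every `Ω`-null vector at
  `mk n w` is a multiple of `L (X, iw)` (pairing with `(0, τ)` forces the `ℂ`-component to be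
  `α(a) · iw`; pairing with `(b, 0)` then puts `a - α(a) X` in the kernel of `Θ̂`);
* `aux_nondegenerate_of_model` — for `t ≠ 0`, `Θ̂_{t²}` is non-degenerate as soon as the model
  form `p^*ωZ + d(t² p^*α)` is non-degenerate at `(n, t)` (rescale `σ` by `2t`);
* `aux_nondegenerate_zero` — `Θ̂_0` is non-degenerate as soon as `ker ωZ_n ⊆ ℝ X` (the intrinsic
  maximal-rank clause, `OrigamiFoldNullLine.lean`);
* **`cutForm_null_imp_smul_circleFundVec`** — the packaged kernel statement at a point of
  `ProdC k N`, and **`cutForm_null_imp_mfderiv_circleQuotientMk_eq_zero`** — the hypothesis of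
  `IsCircleBasicForm.circleDescend_nondegenerate`: `Ω`-null vectors are killed by `dπ`.

Everything here is proved; no definitions, no facts.

## References

* A. Cannas da Silva, V. Guillemin, A. R. Pires, *Symplectic Origami*, IMRN 2011 =
  arXiv:0909.4065, §2.3, proof of Prop. 2.8. [CannasdasilvaGuilleminPires2010]
-/

noncomputable section

open scoped Manifold ContDiff Topology RealInnerProductSpace
open Set Function Filter
open Literature.Geometry.Kaehler Literature.Geometry.Manifold

namespace Literature.Geometry.Symplectic

/-! ### Polymorphic helpers for `1`- and `2`-forms -/

section Helpers

variable {V : Type*} [AddCommGroup V] [Module ℝ V] [TopologicalSpace V]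

/-- A `2`-form is antisymmetric. [folklore] -/
theorem camTwo_swap' (α : V [⋀^Fin 2]→L[ℝ] ℝ) (a b : V) : α ![b, a] = -α ![a, b] := by
  have h := α.map_swap ![a, b] (i := 0) (j := 1) (by decide)
  have hsw : (![a, b] : Fin 2 → V) ∘ Equiv.swap (0 : Fin 2) 1 = ![b, a] := by
    funext k
    fin_cases k <;> rfl
  rw [hsw] at h
  exact h

/-- A `2`-form is additive in its first argument. [folklore] -/
theorem camTwo_add_left' (α : V [⋀^Fin 2]→L[ℝ] ℝ) (a a' b : V) :
    α ![a + a', b] = α ![a, b] + α ![a', b] :=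
  α.vecCons_add ![b] a a'

/-- A `2`-form is homogeneous in its first argument. [folklore] -/
theorem camTwo_smul_left' (α : V [⋀^Fin 2]→L[ℝ] ℝ) (c : ℝ) (a b : V) :
    α ![c • a, b] = c * α ![a, b] :=
  α.vecCons_smul ![b] c a

/-- A `2`-form on a difference in its first argument. [folklore] -/
theorem camTwo_sub_smul_left' (α : V [⋀^Fin 2]→L[ℝ] ℝ) (c : ℝ) (a x b : V) :
    α ![a - c • x, b] = α ![a, b] - c * α ![x, b] := by
  rw [sub_eq_add_neg, ← neg_smul, camTwo_add_left', camTwo_smul_left']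
  ring

/-- A `2`-form kills a repeated argument. [folklore] -/
theorem camTwo_self' (α : V [⋀^Fin 2]→L[ℝ] ℝ) (a : V) : α ![a, a] = 0 :=
  α.map_eq_zero_of_eq ![a, a] (i := 0) (j := 1) rfl (by decide)

/-- A `1`-form is additive. [folklore] -/
theorem camOne_add' (β : V [⋀^Fin 1]→L[ℝ] ℝ) (a a' : V) : β ![a + a'] = β ![a] + β ![a'] :=
  β.vecCons_add ![] a a'

/-- A `1`-form is homogeneous. [folklore] -/
theorem camOne_smul' (β : V [⋀^Fin 1]→L[ℝ] ℝ) (c : ℝ) (a : V) : β ![c • a] = c * β ![a] :=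
  β.vecCons_smul ![] c a

/-- A `1`-form on a difference. [folklore] -/
theorem camOne_sub_smul' (β : V [⋀^Fin 1]→L[ℝ] ℝ) (c : ℝ) (a x : V) :
    β ![a - c • x] = β ![a] - c * β ![x] := by
  rw [sub_eq_add_neg, ← neg_smul, camOne_add', camOne_smul']
  ring

end Helpers

/-! ### The auxiliary form `Θ̂_s` and its non-degeneracy -/

section Aux

variable {V : Type*} [AddCommGroup V] [Module ℝ V] [TopologicalSpace V]

/-- **Non-degeneracy of `Θ̂_{t²}` from non-degeneracy of the model form** (`t ≠ 0`): the model
form at `(n, t)` is `ωZ(a,b) + t² dα(a,b) + 2t(σ α(b) - τ α(a))`, i.e. `Θ̂_{t²}` after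
rescaling `σ, τ` by `2t`. [cite: CannasdasilvaGuilleminPires2010, Prop. 2.8] -/
theorem aux_nondegenerate_of_model (Ω₂ η : V [⋀^Fin 2]→L[ℝ] ℝ) (β : V [⋀^Fin 1]→L[ℝ] ℝ)
    {t : ℝ} (ht : t ≠ 0)
    (hmodel : ∀ (a : V) (σ : ℝ),
      (∀ (b : V) (τ : ℝ), Ω₂ ![a, b] + (t ^ 2 * η ![a, b] + 2 * t * (σ * β ![b] - τ * β ![a])) = 0) →
        a = 0 ∧ σ = 0)
    (a : V) (σ : ℝ)
    (hnull : ∀ (b : V) (τ : ℝ), Ω₂ ![a, b] + t ^ 2 * η ![a, b] + (σ * β ![b] - τ * β ![a]) = 0) :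
    a = 0 ∧ σ = 0 := by
  have h := hmodel a (σ / (2 * t)) fun b τ => by
    have h1 := hnull b (2 * t * τ)
    have e : Ω₂ ![a, b] + (t ^ 2 * η ![a, b] + 2 * t * (σ / (2 * t) * β ![b] - τ * β ![a])) =
        Ω₂ ![a, b] + t ^ 2 * η ![a, b] + (σ * β ![b] - 2 * t * τ * β ![a]) := by
      field_simp
      ring
    rw [e]
    exact h1
  refine ⟨h.1, ?_⟩
  have h2 : σ / (2 * t) = 0 := h.2
  rcases div_eq_zero_iff.1 h2 with h3 | h3
  · exact h3
  · exfalso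
    exact ht (by linarith [mul_eq_zero.1 h3])

/-- **Non-degeneracy of `Θ̂_0` from the maximal-rank clause**: if `ι_X Ω₂ = 0`, `β(X) = 1` and
every `Ω₂`-null vector is a multiple of `X`, then `Θ̂_0((a,σ),·) = 0` forces `(a, σ) = 0`.
[cite: CannasdasilvaGuilleminPires2010, Def. 2.1] -/
theorem aux_nondegenerate_zero (Ω₂ η : V [⋀^Fin 2]→L[ℝ] ℝ) (β : V [⋀^Fin 1]→L[ℝ] ℝ) (X : V)
    (hωX : ∀ b : V, Ω₂ ![X, b] = 0) (hβX : β ![X] = 1)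
    (hker : ∀ a : V, (∀ b : V, Ω₂ ![a, b] = 0) → ∃ c : ℝ, a = c • X)
    (a : V) (σ : ℝ)
    (hnull : ∀ (b : V) (τ : ℝ),
      Ω₂ ![a, b] + ‖(0 : ℂ)‖ ^ 2 * η ![a, b] + (σ * β ![b] - τ * β ![a]) = 0) :
    a = 0 ∧ σ = 0 := by
  have hnull' : ∀ (b : V) (τ : ℝ), Ω₂ ![a, b] + (σ * β ![b] - τ * β ![a]) = 0 := by
    intro b τ
    have h := hnull b τ
    rwa [norm_zero, zero_pow two_ne_zero, zero_mul, add_zero] at h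
  have hβa : β ![a] = 0 := by
    have h := hnull' 0 1
    have h0 : Ω₂ ![a, (0 : V)] = 0 := (Ω₂).map_coord_zero 1 rfl
    have hb0 : β ![(0 : V)] = 0 := (β).map_coord_zero 0 rfl
    rw [h0, hb0] at h
    linarith
  have hσ : σ = 0 := by
    have h := hnull' X 0
    rw [camTwo_swap' Ω₂ X a, hωX a, hβX] at h
    linarith
  have hωa : ∀ b : V, Ω₂ ![a, b] = 0 := fun b => by
    have h := hnull' b 0
    rw [hβa, hσ] at h
    linarith
  obtain ⟨c, rfl⟩ := hker a hωa
  rw [camOne_smul', hβX, mul_one] at hβa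
  subst hβa
  exact ⟨zero_smul _ _, hσ⟩

end Aux

/-! ### The kernel of the cut form -/

variable {k : ℕ} {N : Type*} [TopologicalSpace N] [ChartedSpace (EuclideanSpace ℝ (Fin k)) N]
  [IsManifold (𝓡 k) ∞ N] [MulAction Circle N]

/-- `I w = -w₂ + i w₁`, componentwise. [folklore] -/
private theorem I_mul_re_im (w : ℂ) : (Complex.I * w).re = -w.im ∧ (Complex.I * w).im = w.re := by
  constructor <;> simp

/-- **The kernel of the cut form at `mk n w` lies in the orbit line**, given the
non-degeneracy of the auxiliary form `Θ̂_{|w|²}` at `n` (with `X = X_n`, `ι_X ωZ = 0`,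
`ι_X dα = 0`, `α(X) = 1`): an `Ω`-null tangent vector `L (a, ς)` has `ς = α(a) · iw` (pair with
`(0, τ)`), and `a - α(a) X` is `Θ̂`-null (pair with `(b, τ)`), hence zero.
[cite: CannasdasilvaGuilleminPires2010, Prop. 2.8] -/
theorem cutForm_kernel_of_aux (ωZ : MForm (𝓡 k) N ℝ 2) {α : MForm (𝓡 k) N ℝ 1}
    (hα : IsSmoothForm α) (n : N) (w : ℂ)
    (hωX : ∀ b : TangentSpace (𝓡 k) n, ωZ n ![circleFundVec n, b] = 0)
    (hdαX : ∀ b : TangentSpace (𝓡 k) n, mextDeriv α n ![circleFundVec n, b] = 0)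
    (hαX : α n ![circleFundVec n] = 1)
    (haux : ∀ (a : TangentSpace (𝓡 k) n) (σ : ℝ),
      (∀ (b : TangentSpace (𝓡 k) n) (τ : ℝ),
        ωZ n ![a, b] + ‖w‖ ^ 2 * mextDeriv α n ![a, b] + (σ * α n ![b] - τ * α n ![a]) = 0) →
        a = 0 ∧ σ = 0)
    (a : TangentSpace (𝓡 k) n) (ς : ℂ)
    (hnull : ∀ (b : TangentSpace (𝓡 k) n) (τ : ℂ),
      cutForm ωZ α (ProdC.mk n w : ProdC k N) ![ProdC.tangentLift k a ς, ProdC.tangentLift k b τ] = 0) :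
    ∃ c : ℝ, a = c • circleFundVec n ∧ ς = c • (Complex.I * w) := by
  set X : TangentSpace (𝓡 k) n := circleFundVec n with hX
  -- the value formula
  have hval : ∀ (b : TangentSpace (𝓡 k) n) (τ : ℂ),
      ωZ n ![a, b] + ‖w‖ ^ 2 * mextDeriv α n ![a, b] +
        (2 * ⟪w, ς⟫ * α n ![b] - 2 * ⟪w, τ⟫ * α n ![a]) -
        2 * (ς.re * τ.im - ς.im * τ.re) = 0 := by
    intro b τ
    have h := cutForm_apply_tangentLift_eq ωZ hα (ProdC.mk n w : ProdC k N) a b ς τ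
    rw [ProdC.fst_mk, ProdC.snd_mk] at h
    rw [← h]
    exact hnull b τ
  -- pairing with `(0, τ)`
  have hτ : ∀ τ : ℂ, -(2 * ⟪w, τ⟫ * α n ![a]) - 2 * (ς.re * τ.im - ς.im * τ.re) = 0 := by
    intro τ
    have h := hval 0 τ
    have h1 : ωZ n ![a, (0 : TangentSpace (𝓡 k) n)] = 0 := (ωZ n).map_coord_zero 1 rfl
    have h2 : mextDeriv α n ![a, (0 : TangentSpace (𝓡 k) n)] = 0 :=
      (mextDeriv α n).map_coord_zero 1 rfl
    have h3 : α n ![(0 : TangentSpace (𝓡 k) n)] = 0 := (α n).map_coord_zero 0 rfl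
    rw [h1, h2, h3] at h
    linarith
  have hinner1 : ⟪w, (1 : ℂ)⟫ = w.re := by rw [Complex.inner]; simp
  have hinnerI : ⟪w, Complex.I⟫ = w.im := by rw [Complex.inner]; simp
  -- `ς = α(a) · iw`, componentwise
  have hςim : ς.im = w.re * α n ![a] := by
    have h := hτ 1
    rw [hinner1] at h
    simp only [Complex.one_re, Complex.one_im, mul_zero, mul_one, zero_sub] at h
    linarith
  have hςre : ς.re = -(w.im * α n ![a]) := by
    have h := hτ Complex.I
    rw [hinnerI] at h
    simp only [Complex.I_re, Complex.I_im, mul_zero, mul_one, sub_zero] at h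
    linarith
  have hς : ς = (α n ![a]) • (Complex.I * w) := by
    apply Complex.ext
    · rw [Complex.real_smul, Complex.mul_re, Complex.ofReal_re, Complex.ofReal_im, zero_mul,
        sub_zero, (I_mul_re_im w).1, hςre]
      ring
    · rw [Complex.real_smul, Complex.mul_im, Complex.ofReal_re, Complex.ofReal_im, zero_mul,
        add_zero, (I_mul_re_im w).2, hςim]
      ring
  -- `⟪w, ς⟫ = 0`
  have hwς : ⟪w, ς⟫ = 0 := by
    rw [hς, inner_smul_right, inner_self_I_mul, mul_zero]
  -- pairing with `(b, τ)`: `a' = a - α(a) X` is `Θ̂`-null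
  set c : ℝ := α n ![a] with hc
  have hαa' : α n ![a - c • X] = 0 := by
    rw [camOne_sub_smul', hαX, mul_one, sub_self]
  have hnull' : ∀ (b : TangentSpace (𝓡 k) n) (τ : ℝ),
      ωZ n ![a - c • X, b] + ‖w‖ ^ 2 * mextDeriv α n ![a - c • X, b] +
        (0 * α n ![b] - τ * α n ![a - c • X]) = 0 := by
    intro b τ
    rw [hαa', camTwo_sub_smul_left', camTwo_sub_smul_left', hωX b, hdαX b]
    have h := hval b 0
    rw [hwς] at h
    simp only [inner_zero_right, mul_zero, zero_mul, sub_zero, Complex.zero_re,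
      Complex.zero_im] at h
    linarith
  obtain ⟨ha0, -⟩ := haux (a - c • X) 0 hnull'
  exact ⟨c, sub_eq_zero.1 ha0, hς⟩

/-- **Ω-null vectors at `p` are multiples of the fundamental vector of the diagonal action**
(packaged on tangent vectors of `ProdC k N`). [cite: CannasdasilvaGuilleminPires2010, Prop. 2.8] -/
theorem cutForm_null_imp_smul_circleFundVec
    (hθ : ContMDiff ((𝓡 1).prod (𝓡 k)) (𝓡 k) ∞ (fun x : Circle × N => x.1 • x.2))
    (ωZ : MForm (𝓡 k) N ℝ 2) {α : MForm (𝓡 k) N ℝ 1} (hα : IsSmoothForm α) (p : ProdC k N)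
    (hωX : ∀ b : TangentSpace (𝓡 k) (ProdC.fst p), ωZ (ProdC.fst p) ![circleFundVec (ProdC.fst p), b] = 0)
    (hdαX : ∀ b : TangentSpace (𝓡 k) (ProdC.fst p),
      mextDeriv α (ProdC.fst p) ![circleFundVec (ProdC.fst p), b] = 0)
    (hαX : α (ProdC.fst p) ![circleFundVec (ProdC.fst p)] = 1)
    (haux : ∀ (a : TangentSpace (𝓡 k) (ProdC.fst p)) (σ : ℝ),
      (∀ (b : TangentSpace (𝓡 k) (ProdC.fst p)) (τ : ℝ),
        ωZ (ProdC.fst p) ![a, b] + ‖ProdC.snd p‖ ^ 2 * mextDeriv α (ProdC.fst p) ![a, b] +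
          (σ * α (ProdC.fst p) ![b] - τ * α (ProdC.fst p) ![a]) = 0) → a = 0 ∧ σ = 0)
    (u : TangentSpace (𝓡 (k + 2)) p) (hnull : ∀ u' : TangentSpace (𝓡 (k + 2)) p, cutForm ωZ α p ![u, u'] = 0) :
    ∃ c : ℝ, u = c • circleFundVec p := by
  have hY : circleFundVec p = ProdC.tangentLift k (circleFundVec (ProdC.fst p))
      (Complex.I * ProdC.snd p) := by
    rw [circleFundVec_eq, circleFundVec_eq]
    exact ProdC.mfderiv_circleOrbit_prodC hθ (ProdC.fst p) (ProdC.snd p)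
  have hu : u = ProdC.tangentLift k (mfderiv (𝓡 (k + 2)) (𝓡 k) ProdC.fst p u)
      (mfderiv (𝓡 (k + 2)) 𝓘(ℝ, ℂ) ProdC.snd p u) := ProdC.eq_tangentLift p u
  obtain ⟨c, hac, hςc⟩ := cutForm_kernel_of_aux ωZ hα (ProdC.fst p) (ProdC.snd p) hωX hdαX hαX
    haux (mfderiv (𝓡 (k + 2)) (𝓡 k) ProdC.fst p u) (mfderiv (𝓡 (k + 2)) 𝓘(ℝ, ℂ) ProdC.snd p u)
    fun b τ => by
      have h := hnull (ProdC.tangentLift k b τ)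
      rw [hu] at h
      exact h
  refine ⟨c, ?_⟩
  rw [hu, hY, hac, hςc]
  exact ProdC.tangentLift_smul c _ _

/-- **Ω-null vectors are killed by `dπ`** for the orbit map `π : ProdC k N → N ×_{S¹} ℂ` — the
hypothesis of `IsCircleBasicForm.circleDescend_nondegenerate` at the point `p`.
[cite: CannasdasilvaGuilleminPires2010, Prop. 2.8] -/
theorem cutForm_null_imp_mfderiv_circleQuotientMk_eq_zero [T2Space N]
    (hθ : ContMDiff ((𝓡 1).prod (𝓡 k)) (𝓡 k) ∞ (fun x : Circle × N => x.1 • x.2))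
    (hfree : ∀ (a : Circle) (x : N), a • x = x → a = 1)
    (ωZ : MForm (𝓡 k) N ℝ 2) {α : MForm (𝓡 k) N ℝ 1} (hα : IsSmoothForm α) (p : ProdC k N)
    (hωX : ∀ b : TangentSpace (𝓡 k) (ProdC.fst p), ωZ (ProdC.fst p) ![circleFundVec (ProdC.fst p), b] = 0)
    (hdαX : ∀ b : TangentSpace (𝓡 k) (ProdC.fst p),
      mextDeriv α (ProdC.fst p) ![circleFundVec (ProdC.fst p), b] = 0)
    (hαX : α (ProdC.fst p) ![circleFundVec (ProdC.fst p)] = 1)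
    (haux : ∀ (a : TangentSpace (𝓡 k) (ProdC.fst p)) (σ : ℝ),
      (∀ (b : TangentSpace (𝓡 k) (ProdC.fst p)) (τ : ℝ),
        ωZ (ProdC.fst p) ![a, b] + ‖ProdC.snd p‖ ^ 2 * mextDeriv α (ProdC.fst p) ![a, b] +
          (σ * α (ProdC.fst p) ![b] - τ * α (ProdC.fst p) ![a]) = 0) → a = 0 ∧ σ = 0)
    (u : TangentSpace (𝓡 (k + 2)) p) (hnull : ∀ u' : TangentSpace (𝓡 (k + 2)) p, cutForm ωZ α p ![u, u'] = 0) :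
    letI := circleQuotientChartedSpace (EuclideanSpace ℝ (Fin (k + 1)))
      (ProdC.contMDiff_smul_prodC hθ) (ProdC.smul_eq_self_prodC hfree)
      (show Module.finrank ℝ (EuclideanSpace ℝ (Fin (k + 1))) + 1 = k + 2 by rw [finrank_euclideanSpace_fin])
    mfderiv (𝓡 (k + 2)) 𝓘(ℝ, EuclideanSpace ℝ (Fin (k + 1)))
      (circleQuotientMk : ProdC k N → CircleQuotient (ProdC k N)) p u = 0 := by
  letI := circleQuotientChartedSpace (EuclideanSpace ℝ (Fin (k + 1)))
    (ProdC.contMDiff_smul_prodC hθ) (ProdC.smul_eq_self_prodC hfree)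
    (show Module.finrank ℝ (EuclideanSpace ℝ (Fin (k + 1))) + 1 = k + 2 by rw [finrank_euclideanSpace_fin])
  obtain ⟨c, rfl⟩ := cutForm_null_imp_smul_circleFundVec hθ ωZ hα p hωX hdαX hαX haux u hnull
  rw [map_smul, circleFundVec_eq,
    mfderiv_circleQuotientMk_apply_orbit (ProdC.contMDiff_smul_prodC hθ)
      (ProdC.smul_eq_self_prodC hfree) (show Module.finrank ℝ (EuclideanSpace ℝ (Fin (k + 1))) + 1 = k + 2 by rw [finrank_euclideanSpace_fin]) p, smul_zero]

end Literature.Geometry.Symplectic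

end
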